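import Literature.AlgebraicGeometry.HodgeTheory.ProjectionFromVertexHomology
import Literature.AlgebraicGeometry.HodgeTheory.CycleClassDivEqZeroOfSmooth
import Literature.AlgebraicGeometry.Resolution.AlterationsLemma411VertexBlowupHolds
import Literature.AlgebraicGeometry.Resolution.BlowupSmoothProjective
import Literature.AlgebraicGeometry.Resolution.BlowupRegularPoints
import Literature.AlgebraicGeometry.Motives.CyclesPushforwardProofs
import Literature.AlgebraicGeometry.Motives.CartierDivisorCurveDegree
import Literature.AlgebraicGeometry.Motives.CartierDivisorClassPullback
import HarnessLib

/-!
# `[div ψ] = 0` on `ℙ^{d+1}` for `ψ` a unit at the vertex (Voisin II, Lemma 9.18, through the blow-up)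

Family `hodge`, layer `Literature/AlgebraicGeometry/HodgeTheory`. The heart of the `ℙ^{d+1}`-case of
Voisin's Lemma 9.18 ("if `Z` is rationally equivalent to `0`, then `[Z] = 0`") for the cycle class of
the tree (`cycleClass`, through resolution families, relative to the complex orientation family),
granted Fulton's degree formula for the complex orientations (`OrientationFamily.HasDegreeFormula`,
Lemma 19.1.2 — the hypothesis `hA`): for a rational function `ψ ∈ K(ℙ^{d+1})ˣ` which is a UNIT at the
vertex `(0 : … : 0 : 1)`, the `d`-cycle `div ψ` has `[div ψ] = 0 ∈ H²(ℙ^{d+1}(ℂ); ℂ)`.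

The proof avoids every local analysis of Gysin classes: let `b : T → ℙ^{d+1}` be the blow-up in the
vertex with its projection `q : T → ℙ^d` (de Jong 1996, proof of Lemma 4.11: the tree's theorem
`DeJong1996VertexBlowupProjection_holds`; `T` is smooth projective, Hartshorne II 8.24 (a)); for
`ψ̃ = b^*ψ` and `D = div ψ̃`, `b_* D = div ψ` (Fulton Prop. 1.4 (b), the tree's theorem
`map_div_eq_div_norm_holds`, `b` birational) and `q_* D = 0` (Fulton Prop. 1.4 (a), the tree's theorem
`map_div_eq_zero_of_dim_eq_add_one_holds`), so `[div ψ] = b_* [D]` and `q_* [D] = [q_* D] = 0` by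
`[f_* Z] = f_* [Z]` (Voisin II Prop. 9.21 (ii), `cycleClass_cyclesOfDimMap`, from the degree formula).
Since `ψ` is a unit at the vertex, no component of `D` meets the exceptional divisor, so
`[D] ⌢ [T(ℂ)]` comes from `H_{2d}` of `b⁻¹(ℙ^{d+1} ∖ vertex) ≅ ℙ^{d+1} ∖ vertex`, on which `q = pr ∘ b`;
as `pr(ℂ)_*` is one-to-one there (`HodgeTheory/ProjectionFromVertexHomology`), `b(ℂ)_* ([D] ⌢ [T]) = 0`,
i.e. `[div ψ] ⌢ [ℙ^{d+1}(ℂ)] = 0`, and Poincaré duality concludes.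

* `isSmoothProjective_of_isBlowup_closedPoint` — the blow-up of a smooth projective complex variety
  in a closed point is smooth projective of the same dimension (Hartshorne II 8.24 (a), 7.16 (c));
* `exists_vertexBlowup_isSmoothProjective` — the blow-up of `ℙ^{d+1}_ℂ` in the vertex with its
  projection to `ℙ^d`, over `ℂ`, smooth projective;
* `cycleClass_div_eq_zero_of_isUnitAt_vertex` — **`[div ψ] = 0` on `ℙ^{d+1}` for `ψ` a unit at the
  vertex**, granted the degree formula.

Everything is proved; no definitions, no named facts.

## References

* [VoisinHodgeII2003] C. Voisin, Hodge Theory and Complex Algebraic Geometry II, CUP 2003, Lemma 9.18,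
  Prop. 9.21 (ii).
* [Fulton1998] W. Fulton, Intersection Theory, 2nd ed. 1998, Prop. 1.4, Lemma 19.1.2.
* [DeJong1996] A. J. de Jong, Smoothness, semi-stability and alterations, Publ. Math. IHÉS 83 (1996),
  proof of Lemma 4.11, p. 68.
* [Hartshorne1977] R. Hartshorne, Algebraic Geometry, GTM 52, II Prop. 7.16 (c), II Thm. 8.24 (a).
* [Liu2002] Q. Liu, Algebraic Geometry and Arithmetic Curves, OUP 2002, Thm. 8.1.19 (a).
-/

noncomputable section

open CategoryTheory CategoryTheory.Limits AlgebraicGeometry Order TopologicalSpace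
open Literature.AlgebraicTopology.SingularHomology
open Literature.AlgebraicGeometry.Motives Literature.AlgebraicGeometry.Resolution

namespace Literature.AlgebraicGeometry.HodgeTheory

section HodgeTheory

/-! ### The blow-up of a smooth projective variety in a closed point is smooth projective -/

variable {n : ℕ} {X : Motives.SchemeOver ℂ}

/-- **The blowing up of a smooth projective complex variety in a closed point is smooth projective of
the same dimension** (Hartshorne II 8.24 (a), II 7.16 (c)): regular over the centre by Liu 8.1.19 (a)
for the finite set `{p}` of closed points (`IsBlowup.isRegularLocalRing_stalk_of_finite`) and a local
isomorphism off it, hence smooth over `ℂ`; projective (`blowupProjectiveOverField_holds`); of relative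
dimension `n` (read off over the complement of `p`); geometrically integral.
[cite: Hartshorne1977, II Thm. 8.24 (a) and Prop. 7.16 (c)] [cite: Liu2002, Thm. 8.1.19 (a)] -/
theorem isSmoothProjective_of_isBlowup_closedPoint (hX : IsSmoothProjective n X) {p : X.left}
    (hp : IsClosed ({p} : Set X.left))
    (hJ : Scheme.IdealSheafData.vanishingIdeal (⟨{p}, hp⟩ : Closeds X.left) ≠ ⊥) {X' : Scheme.{0}}
    {π : X' ⟶ X.left} (hπ : IsBlowup π (Scheme.IdealSheafData.vanishingIdeal ⟨{p}, hp⟩)) :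
    IsSmoothProjective n (Over.mk (π ≫ X.hom) : SchemeOver ℂ) := by
  set J : X.left.IdealSheafData := Scheme.IdealSheafData.vanishingIdeal ⟨{p}, hp⟩ with hJdef
  haveI := hX.smoothOfRelativeDimension
  haveI : IsIntegral X.left := IsSmoothProjective.isIntegral_holds hX
  haveI : IsProper X.hom := hX.isProjectiveOver.isProper
  haveI : IsLocallyNoetherian X.left := LocallyOfFiniteType.isLocallyNoetherian X.hom
  have hreg : ∀ x : X.left, IsRegularLocalRing (X.left.presheaf.stalk x) := fun x ↦
    isRegularLocalRing_stalk_of_smoothOfRelativeDimension X.hom n x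
  have hproj : IsProjectiveOver (Over.mk X.hom) := isProjectiveOver_mk_hom hX.isProjectiveOver
  -- `X'` is regular: over `p` by Liu 8.1.19 (a), off it `π` is a local isomorphism
  have hreg' : Scheme.IsRegular X' := by
    intro x'
    by_cases hx : π x' ∈ ({p} : Set X.left)
    · have hRo : IsOpen (Scheme.regularLocus X.left) := by
        have : Scheme.regularLocus X.left = Set.univ := Set.eq_univ_of_forall fun x ↦ hreg x
        rw [this]
        exact isOpen_univ
      exact hπ.isRegularLocalRing_stalk_of_finite hRo hp (Set.finite_singleton _)
        (fun s hs ↦ by rw [Set.mem_singleton_iff.1 hs]; exact hp) (fun x _ ↦ hreg x) hx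
    · set U : X'.Opens := π ⁻¹ᵁ centreCompl J with hU
      have hx' : x' ∈ U := by
        rw [hU]
        change π x' ∈ ((J.support : Set X.left))ᶜ
        rw [hJdef, Scheme.IdealSheafData.coe_support_vanishingIdeal]
        exact hx
      haveI hoi : IsOpenImmersion (U.ι ≫ π) := by
        rw [hU]
        exact hπ.isOpenImmersion_preimage_compl_ι
      have h2 : IsIso (π.stalkMap x' ≫ U.ι.stalkMap ⟨x', hx'⟩) := by
        have h3 : IsIso ((U.ι ≫ π).stalkMap ⟨x', hx'⟩) := inferInstance
        rw [Scheme.Hom.stalkMap_comp] at h3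
        exact h3
      have h4 : IsIso (U.ι.stalkMap ⟨x', hx'⟩) := inferInstance
      haveI : IsIso (π.stalkMap x') :=
        @IsIso.of_isIso_comp_right _ _ _ _ _ (π.stalkMap x') (U.ι.stalkMap ⟨x', hx'⟩) h4 h2
      haveI := hreg (π x')
      exact IsRegularLocalRing.of_ringEquiv (asIso (π.stalkMap x')).commRingCatIsoToRingEquiv
  -- integral, projective, proper
  haveI hint : IsIntegral X' := hπ.isIntegral hJ
  have hproj' : IsProjectiveOver (Over.mk (π ≫ X.hom) : SchemeOver ℂ) :=
    blowupProjectiveOverField_holds ℂ X.left X' X.hom J π inferInstance hproj hJ hπ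
  haveI : IsProper (π ≫ X.hom) :=
    IsProjectiveOver.isProper (X := (Over.mk (π ≫ X.hom) : SchemeOver ℂ)) hproj'
  -- smooth of some relative dimension, which is `n` (read off off the centre)
  haveI : Smooth (π ≫ X.hom) := smooth_of_isRegular_of_perfectField (π ≫ X.hom) hreg'
  obtain ⟨m, hm⟩ := exists_smoothOfRelativeDimension_of_smooth (π ≫ X.hom)
  haveI := hm
  haveI : IsIso (π ∣_ centreCompl J) := hπ.isIso_compl
  have hUne : ((centreCompl J : X.left.Opens) : Set X.left).Nonempty := centreCompl_nonempty hJ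
  have hU'ne : ((π ⁻¹ᵁ centreCompl J : X'.Opens) : Set X').Nonempty := by
    obtain ⟨x, hx⟩ := hUne
    obtain ⟨y, hy⟩ := (Scheme.homeoOfIso (asIso (π ∣_ centreCompl J))).surjective ⟨x, hx⟩
    exact ⟨y.1, y.2⟩
  have hmn : m = n := by
    have h1 := topologicalKrullDim_opens_eq X.hom (centreCompl J) hUne
    have h2 := topologicalKrullDim_opens_eq (π ≫ X.hom) (π ⁻¹ᵁ centreCompl J) hU'ne
    have h3 : topologicalKrullDim ((π ⁻¹ᵁ centreCompl J : X'.Opens) : Scheme.{0}) =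
        topologicalKrullDim ((centreCompl J : X.left.Opens) : Scheme.{0}) :=
      IsHomeomorph.topologicalKrullDim_eq _
        (Scheme.homeoOfIso (asIso (π ∣_ centreCompl J))).isHomeomorph
    have h4 := topologicalKrullDim_eq_of_smoothOfRelativeDimension (π ≫ X.hom) m
    have h5 := topologicalKrullDim_eq_of_smoothOfRelativeDimension X.hom n
    have : (m : WithBot ℕ∞) = n := h4.symm.trans (h2.symm.trans (h3.trans (h1.trans h5)))
    exact_mod_cast this
  subst hmn
  haveI := geometricallyIntegral_of_isAlgClosed (π ≫ X.hom)
  have hgi : GeometricallyIrreducible (π ≫ X.hom) := inferInstance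
  exact ⟨hm, hproj', hgi⟩

/-- **The blow-up of `ℙ^{d+1}_ℂ` in the vertex with its projection to `ℙ^d`, over `ℂ`**: a smooth
projective `(d+1)`-fold `T` with `b : T → ℙ^{d+1}` a blowing up in the vertex `(0 : … : 0 : 1)` and
`q : T → ℙ^d` surjective with `q = pr ∘ b` off the exceptional divisor (de Jong 1996, proof of
Lemma 4.11 — the tree's theorem `DeJong1996VertexBlowupProjection_holds`; Eisenbud–Harris Prop. 9.11).
[cite: DeJong1996, Lemma 4.11 (proof), p. 68] [cite: Hartshorne1977, II Thm. 8.24 (a)] -/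
theorem exists_vertexBlowup_isSmoothProjective (d : ℕ) :
    ∃ (T : SchemeOver ℂ) (b : T ⟶ projectiveSpace (d + 1) ℂ) (q : T ⟶ projectiveSpace d ℂ),
      IsSmoothProjective (d + 1) T ∧ IsBlowup b.left (DeJong1996.vertexIdealSheaf d ℂ) ∧
      DeJong1996.IsVertexProjection d ℂ b.left q.left ∧ Function.Surjective q.left.base := by
  obtain ⟨P', b₀, q₀, hbq, hV⟩ := DeJong1996VertexBlowupProjection_holds ℂ d
  refine ⟨Over.mk (b₀ ≫ (projectiveSpace (d + 1) ℂ).hom), Over.homMk b₀ rfl,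
    Over.homMk q₀ hbq.comp_hom,
    isSmoothProjective_of_isBlowup_closedPoint (isSmoothProjective_projectiveSpace' (d + 1))
      (DeJong1996.isClosed_singleton_vertex d ℂ) (DeJong1996.vertexIdealSheaf_ne_bot d ℂ) hbq.isBlowup,
    hbq.isBlowup, hV, fun y ↦ ?_⟩
  obtain ⟨e, -, he⟩ := hbq.exists_apply_eq y
  exact ⟨e, he⟩

/-! ### `[div ψ] = 0` on `ℙ^{d+1}` for `ψ` a unit at the vertex -/

/-- **Voisin II, Lemma 9.18 on `ℙ^{d+1}_ℂ` for a rational function which is a unit at the vertex**,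
granted Fulton's degree formula for the complex orientations: for `ψ ∈ K(ℙ^{d+1})ˣ` with
`ψ ∈ 𝒪_{ℙ^{d+1}, vertex}^×` and the `d`-cycle `c = div ψ`, `[c] = 0 ∈ H²(ℙ^{d+1}(ℂ); ℂ)` (cycle class
through any resolution family `ρ`). Proof: let `b : T → ℙ^{d+1}` be the blow-up in the vertex and
`q : T → ℙ^d` its projection (`T` smooth projective); `ψ̃ = b^*ψ`, `D = div ψ̃`. Then `b_* D = div ψ`
(Fulton Prop. 1.4 (b), `b` birational) and `q_* D = 0` (Fulton Prop. 1.4 (a)), so `[c] = b_* [D]` and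
`q_* [D] = [q_* D] = 0` (`[f_* Z] = f_* [Z]`, Voisin II Prop. 9.21 (ii), from the degree formula). As
`ψ` is a unit at the vertex, no component of `D` meets the exceptional divisor, so
`[D] ⌢ [T(ℂ)] = ι̃(ℂ)_* w` for a class `w ∈ H_{2d}(b⁻¹(ℙ^{d+1} ∖ vertex)(ℂ))`; off the exceptional divisor
`q = pr ∘ b` (`DeJong1996.IsVertexProjection`), so `pr(ℂ)_* (b|(ℂ)_* w) = q(ℂ)_* ([D] ⌢ [T]) = 0`, whence
`b|(ℂ)_* w = 0` (`pr(ℂ)_*` is one-to-one on `H_{2d}((ℙ^{d+1} ∖ vertex)(ℂ))`,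
`injective_singularHomology_map_vertexProjectionOver`) and `[c] ⌢ [ℙ^{d+1}(ℂ)] = b(ℂ)_* ([D] ⌢ [T]) = 0`;
Poincaré duality. [cite: VoisinHodgeII2003, Lemma 9.18 and Prop. 9.21 (ii)]
[cite: Fulton1998, Prop. 1.4 and Lemma 19.1.2] [cite: DeJong1996, Lemma 4.11 (proof), p. 68] -/
theorem cycleClass_div_eq_zero_of_isUnitAt_vertex (hA : complexOrientationFamily.HasDegreeFormula)
    (d : ℕ) (ρ : ResolutionFamily (projectiveSpace (d + 1) ℂ) d)
    [IsIntegral (projectiveSpace (d + 1) ℂ).left] [IsLocallyNoetherian (projectiveSpace (d + 1) ℂ).left]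
    (ψ : (projectiveSpace (d + 1) ℂ).left.functionField) (hψ : ψ ≠ 0)
    (hunit : RatFn.IsUnitAt (DeJong1996.vertex d ℂ) ψ)
    {c : AlgebraicCycle (projectiveSpace (d + 1) ℂ).left ℤ}
    (hc : c ∈ Motives.cyclesOfDim (projectiveSpace (d + 1) ℂ).left d)
    (hcψ : ⇑c = fun z ↦ Scheme.ord ψ z) :
    cycleClass complexOrientationFamily (isSmoothProjective_projectiveSpace' (d + 1)) rfl ρ ⟨c, hc⟩ = 0 := by
  classical
  have hP : IsSmoothProjective (d + 1) (projectiveSpace (d + 1) ℂ) :=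
    isSmoothProjective_projectiveSpace' (d + 1)
  have hQ : IsSmoothProjective d (projectiveSpace d ℂ) := isSmoothProjective_projectiveSpace' d
  have hPDμ := hasPoincareDuality_complexOrientationFamily
  haveI : LocallyOfFiniteType (projectiveSpace (d + 1) ℂ).hom := locallyOfFiniteType_of_isSmoothProjective hP
  haveI : LocallyOfFiniteType (projectiveSpace d ℂ).hom := locallyOfFiniteType_of_isSmoothProjective hQ
  haveI : IsIntegral (projectiveSpace d ℂ).left := IsSmoothProjective.isIntegral_holds hQ
  haveI : IsLocallyNoetherian (projectiveSpace d ℂ).left :=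
    LocallyOfFiniteType.isLocallyNoetherian (projectiveSpace d ℂ).hom
  haveI := irreducibleSpace_of_isSmoothProjective' hP
  haveI := irreducibleSpace_of_isSmoothProjective' hQ
  -- (0) the blow-up in the vertex with its projection to `ℙ^d`
  obtain ⟨T, b, q, hT, hb, hV, hqsurj⟩ := exists_vertexBlowup_isSmoothProjective d
  haveI : IsIntegral T.left := IsSmoothProjective.isIntegral_holds hT
  haveI : LocallyOfFiniteType T.hom := locallyOfFiniteType_of_isSmoothProjective hT
  haveI : IsLocallyNoetherian T.left := LocallyOfFiniteType.isLocallyNoetherian T.hom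
  haveI := irreducibleSpace_of_isSmoothProjective' hT
  haveI : IsProper b.left := isProper_left_of_isSmoothProjective hT hP b
  haveI : IsProper q.left := isProper_left_of_isSmoothProjective hT hQ q
  haveI : IsDominant b.left := DeJong1996.isDominant_of_isBlowup_vertex hb
  haveI : IsDominant q.left := ⟨hqsurj.denseRange⟩
  have hbir : IsBirational b.left := hb.isBirational' (DeJong1996.vertexIdealSheaf_ne_bot d ℂ)
  -- (1) the pulled-back function `ψ' = b^* ψ` and its divisor `D`, a `d`-cycle on `T`
  set ψ' : T.left.functionField := RatFn.functionFieldMap b.left ψ with hψ'def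
  have hψ' : ψ' ≠ 0 := by
    rw [hψ'def]
    exact (map_ne_zero_iff _ (RatFn.functionFieldMap b.left).injective).2 hψ
  haveI : IsLocallyNoetherian (Motives.ClosedSubvariety.top T.left).carrier :=
    inferInstanceAs (IsLocallyNoetherian T.left)
  set D : AlgebraicCycle T.left ℤ := (Motives.ClosedSubvariety.top T.left).div
    (Motives.ClosedSubvariety.top T.left).locallyFiniteSupport_divFun_holds ψ' with hDdef
  have hD : ⇑D = (Motives.ClosedSubvariety.top T.left).divFun ψ' := rfl
  have hDord : ⇑D = fun w ↦ Scheme.ord ψ' w :=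
    hD.trans (Motives.ClosedSubvariety.divFun_top T.left ψ')
  have hTgen : height (genericPoint T.left) = (d + 1 : ℕ) :=
    height_eq_of_isGenericPoint hT (genericPoint_spec _)
  have hTtop : height (⊤ : T.left) = (d + 1 : ℕ) := hTgen
  have hPtop : height (⊤ : (projectiveSpace (d + 1) ℂ).left) = (d + 1 : ℕ) :=
    height_eq_of_isGenericPoint hP (genericPoint_spec _)
  have hQtop : height (⊤ : (projectiveSpace d ℂ).left) = (d : ℕ) :=
    height_eq_of_isGenericPoint hQ (genericPoint_spec _)
  have hWT : (Motives.ClosedSubvariety.top T.left).dim = d + 1 := by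
    rw [Motives.ClosedSubvariety.dim_top, hTgen, Nat.cast_add_one]
  have hDdim : D ∈ Motives.cyclesOfDim T.left d :=
    Motives.divFun_mem_cyclesOfDim_holds T (Motives.ClosedSubvariety.top T.left) hWT hψ' D hD
  -- (2) Fulton Prop. 1.4 (b) along `b`: `b_* D = div ψ = c` (`b` birational, `Nm(b^*ψ) = ψ`)
  have hbD : AlgebraicCycle.map b.left height height D = c := by
    have h := Motives.map_div_eq_div_norm_holds b (d + 1) hTtop hPtop ψ' hψ' D hDord
    rw [hψ'def, norm_functionFieldMap_of_isBirational hbir ψ] at h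
    ext z
    rw [hcψ]
    exact congrFun h z
  -- (3) Fulton Prop. 1.4 (a) along `q`: `q_* D = 0`
  have hqD : AlgebraicCycle.map q.left height height D = 0 :=
    Motives.map_div_eq_zero_of_dim_eq_add_one_holds q d hTtop hQtop ψ' hψ' D hDord
  -- (4) cycle classes (`[f_* Z] = f_* [Z]`): `[c] = b_* [D]` and `q_* [D] = [q_* D] = 0`
  obtain ⟨ρT⟩ := nonempty_resolutionFamily hT d
  obtain ⟨ρQ⟩ := nonempty_resolutionFamily hQ d
  set y := cycleClass complexOrientationFamily hT rfl ρT ⟨D, hDdim⟩ with hydef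
  have hcl_b : cycleClass complexOrientationFamily hP rfl ρ ⟨c, hc⟩ =
      complexGysin complexOrientationFamily hT hP b
        (show 2 * 1 + 2 * (d + 1) = 2 * 1 + 2 * (d + 1) from rfl) y := by
    have hsub : (⟨c, hc⟩ : ↥(Motives.cyclesOfDim _ d)) = Motives.cyclesOfDimMap d b.left ⟨D, hDdim⟩ :=
      Subtype.ext (by rw [Motives.coe_cyclesOfDimMap]; exact hbD.symm)
    rw [hsub, cycleClass_cyclesOfDimMap hA hT hP b rfl rfl ρT ρ ⟨D, hDdim⟩]
  have hcl_q : complexGysin complexOrientationFamily hT hQ q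
      (show 2 * 1 + 2 * d = 2 * 0 + 2 * (d + 1) by omega) y = 0 := by
    have hsub : Motives.cyclesOfDimMap d q.left ⟨D, hDdim⟩ = 0 :=
      Subtype.ext (by rw [Motives.coe_cyclesOfDimMap, hqD]; rfl)
    rw [hydef, ← cycleClass_cyclesOfDimMap hA hT hQ q rfl (Nat.add_zero d) ρT ρQ ⟨D, hDdim⟩, hsub,
      map_zero]
  -- (5) in homology: `q(ℂ)_* ([D] ⌢ [T]) = 0`; it suffices that `b(ℂ)_* ([D] ⌢ [T]) = 0`
  have h2d : 2 * 1 + 2 * d = 2 * (d + 1) := by ring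
  set yT := capProduct h2d y (complexOrientationFamily hT).fundamentalClass with hyTdef
  have hq_hom : singularHomology.map ℂ ℂ (AlgPoints.mapContinuous (L := ℂ) q) (2 * d) yT = 0 := by
    rw [hyTdef, ← capProduct_complexGysin hPDμ hT hQ q
      (show 2 * 1 + 2 * d = 2 * 0 + 2 * (d + 1) by omega) h2d (show 2 * 0 + 2 * d = 2 * d by ring) y,
      hcl_q, map_zero, LinearMap.zero_apply]
  suffices hb_hom : singularHomology.map ℂ ℂ (AlgPoints.mapContinuous (L := ℂ) b) (2 * d) yT = 0 by
    apply (hPDμ hP h2d).1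
    rw [poincareDualityMap_apply, poincareDualityMap_apply, map_zero, LinearMap.zero_apply, hcl_b,
      capProduct_complexGysin hPDμ hT hP b _ h2d h2d y]
    exact hb_hom
  -- (6) support: every component of `D` maps into `ℙ^{d+1} ∖ {vertex}` (`ψ` is a unit at the vertex)
  set U₀ : (projectiveSpace (d + 1) ℂ).left.Opens := DeJong1996.puncturedSpace d ℂ with hU₀def
  have hsupp : ∀ w : T.left, D w ≠ 0 → ∀ v ∈ closure ({w} : Set T.left), b.left.base v ∈ U₀ := by
    intro w hw v hv
    refine (DeJong1996.mem_puncturedSpace_iff d ℂ _).2 fun hvert ↦ ?_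
    have h1 : b.left.base v ∈ closure ({b.left.base w} : Set (projectiveSpace (d + 1) ℂ).left) := by
      have h := image_closure_subset_closure_image b.left.continuous (Set.mem_image_of_mem b.left.base hv)
      rwa [Set.image_singleton] at h
    rw [hvert] at h1
    have h2 : b.left.base w ⤳ DeJong1996.vertex d ℂ := specializes_iff_mem_closure.2 h1
    have h3 : RatFn.IsUnitAt (b.left.base w) ψ := hunit.of_specializes h2
    have h4 : RatFn.IsUnitAt w ψ' := h3.functionFieldMap
    apply hw
    rw [hDord]
    exact h4.ord_eq_zero
  -- (7) the open `Ũ = b⁻¹(ℙ^{d+1} ∖ vertex)` of `T` over `ℂ` and `β = b| : Ũ → ℙ^{d+1} ∖ vertex`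
  set Ut : Motives.SchemeOver ℂ := Motives.openSubschemeOver T (b.left ⁻¹ᵁ U₀) with hUtdef
  set ιt : Ut ⟶ T := Motives.openSubschemeOverι T (b.left ⁻¹ᵁ U₀) with hιtdef
  have hβw : (b.left ∣_ U₀) ≫ (puncturedOver d).hom = Ut.hom := by
    change (b.left ∣_ U₀) ≫ U₀.ι ≫ (projectiveSpace (d + 1) ℂ).hom = (b.left ⁻¹ᵁ U₀).ι ≫ T.hom
    rw [← Category.assoc, morphismRestrict_ι, Category.assoc, Over.w b]
  set β : Ut ⟶ puncturedOver d := Over.homMk (b.left ∣_ U₀) hβw with hβdef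
  have hβb : ιt ≫ b = β ≫ puncturedOverι d := by
    ext : 1
    change (b.left ⁻¹ᵁ U₀).ι ≫ b.left = (b.left ∣_ U₀) ≫ U₀.ι
    exact (morphismRestrict_ι _ _).symm
  have hβq : ιt ≫ q = β ≫ vertexProjectionOver d := by
    ext : 1
    change (b.left ⁻¹ᵁ U₀).ι ≫ q.left = (b.left ∣_ U₀) ≫ DeJong1996.vertexProjection d ℂ
    exact hV.preimage_ι_comp d ℂ
  -- (8) the resolutions of the components of `D` lift to `Ũ`
  have hheight : ∀ w : T.left, D w ≠ 0 → height w = (d : ℕ∞) := fun w hw ↦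
    Motives.mem_cyclesOfDim_iff.1 hDdim w hw
  have hlift : ∀ (w : T.left) (hw : D w ≠ 0) (v : (ρT.V ⟨w, hheight w hw⟩).left),
      (ρT.hom ⟨w, hheight w hw⟩).left.base v ∈ b.left ⁻¹ᵁ U₀ :=
    fun w hw v ↦ hsupp w hw _ (ρT.base_mem_closure ⟨w, hheight w hw⟩ v)
  let t : ∀ (w : T.left) (hw : D w ≠ 0), ρT.V ⟨w, hheight w hw⟩ ⟶ Ut := fun w hw ↦
    liftOpenSubschemeOver (b.left ⁻¹ᵁ U₀) (ρT.hom ⟨w, hheight w hw⟩) (hlift w hw)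
  have ht : ∀ w hw, t w hw ≫ ιt = ρT.hom ⟨w, hheight w hw⟩ := fun w hw ↦
    liftOpenSubschemeOver_ι _ _ _
  let cls : T.left → singularHomology ℂ ℂ (ComplexPoints Ut) (2 * d) := fun w ↦
    if hw : D w ≠ 0 then singularHomology.map ℂ ℂ (AlgPoints.mapContinuous (L := ℂ) (t w hw)) (2 * d)
      (complexOrientationFamily (ρT.smooth ⟨w, hheight w hw⟩)).fundamentalClass else 0
  obtain ⟨s, hs⟩ : ∃ s : Finset T.left, Function.support ⇑D ⊆ s :=
    ⟨(finite_support_of_isSmoothProjective hT D).toFinset, by simp⟩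
  set wU : singularHomology ℂ ℂ (ComplexPoints Ut) (2 * d) := ∑ w ∈ s, ((D w : ℤ) : ℂ) • cls w
    with hwUdef
  -- (9) `[D] ⌢ [T(ℂ)] = ι̃(ℂ)_* wU`
  have hyT : yT = singularHomology.map ℂ ℂ (AlgPoints.mapContinuous (L := ℂ) ιt) (2 * d) wU := by
    rw [hyTdef, hydef, cycleClass_eq_sum complexOrientationFamily hT rfl ρT ⟨D, hDdim⟩ hs, map_sum,
      LinearMap.sum_apply, hwUdef, map_sum]
    refine Finset.sum_congr rfl fun w _ ↦ ?_
    rw [map_smul, LinearMap.smul_apply, map_smul]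
    change ((D w : ℤ) : ℂ) • _ = ((D w : ℤ) : ℂ) • _
    by_cases hDw : D w = 0
    · rw [show ((D w : ℤ) : ℂ) = 0 by rw [hDw, Int.cast_zero], zero_smul, zero_smul]
    · congr 1
      simp only [cls, dif_pos hDw]
      rw [primeClass_of_height_eq complexOrientationFamily hT rfl ρT (hheight w hDw),
        capProduct_complexGysin_one hPDμ (ρT.smooth _) hT (ρT.hom _) (rfl : d + 1 = d + 1),
        ← singularHomology_map_comp_apply, ht w hDw]
  -- (10) `q_* = pr_* ∘ β_*` on `Ũ`, `pr_*` is one-to-one, and `b_* = j_* ∘ β_*` on `Ũ`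
  have hβ0 : singularHomology.map ℂ ℂ (AlgPoints.mapContinuous (L := ℂ) β) (2 * d) wU = 0 := by
    apply injective_singularHomology_map_vertexProjectionOver d hA
    rw [map_zero, ← singularHomology_map_comp_apply, ← hβq, singularHomology_map_comp_apply, ← hyT]
    exact hq_hom
  rw [hyT, ← singularHomology_map_comp_apply, hβb, singularHomology_map_comp_apply, hβ0, map_zero]

end HodgeTheory

end Literature.AlgebraicGeometry.HodgeTheory

end
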